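import Literature.MathematicalPhysics.QuantumFieldTheory.Balaban1983to89.T3RestrictedUnitDensity
import HarnessLib

/-!
# `Balaban1983to89.T3TiltDescent` — rung R3, crux K1 LOCALISED AT THE COMPARISON SCALE `η = L^{-n}`: tilts push forward under
# EVERY measurable map («the free block averagings cost nothing», [King1986] (3.9) ⇒ Thm 2.1), the unit transport of the `K`-th
# approximation factors through that of the `n`-th (`A_K = A_n ∘ D_{n,K}`, `D_{n,K}` = `K − n` averagings read on the `n`-th tower),
# hence the route's K1 at step `K` FOLLOWS from a tilt — or from a two-run sandwich of Bałaban's FULLY-CONSTRAINED restricted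
# densities — between the two runs descended to the finest lattice of the `n`-th approximation (spacing `η = L^{-n}`)

Cell `ym3-torus` (HUMAN RULING D-0037, YM ladder rung R3), seat `ym3-torus-p2` gen 3.  WHAT THIS IS NOT: not d = 4, not infinite
volume, not a mass gap, not Clay, NOT K1: the descended tilt / sandwich is the HYPOTHESIS — it is the d = 3 expectations step
(two cut-offs compared in the small-field region at the last constrained height; printed abelian template [King1986] Thm 3.4 and
Props 3.8/3.9; for pure `SU(2)` Yang–Mills [Balaban1985UV3] (41)/(47) print one-run envelopes only).

THE POINT.  The route `UnitScaleTilt` leaves the top `⌊K/m⌋` block averagings FREE (its event `histGood K (K/m)` constrains the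
heights `j ≤ K − ⌊K/m⌋` only), because unit-scale large fields have `K`-independent mass.  King's device: compare the two runs at
the LAST CONSTRAINED HEIGHT — the lattice of spacing `η = L^{-n}`, `n = ⌊K/m⌋`, where the small-field expansion holds with effective
coupling `g² = γη → 0` — and then apply the COMMON remaining averagings to both.  This file proves that the second half is free:
§1 **`IsTilt.map_measure`** — if `ν = C·e^{h}·μ` with `sup |h| ≤ r` (finite `μ`) then for EVERY measurable `f` the push-forwards
   satisfy `ν.map f = C·e^{h'}·(μ.map f)` with `sup |h'| ≤ r` (the conditional expectation of a density in `[Ce^{−r}, Ce^{r}]` lies in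
   the same interval; Radon–Nikodym + clipping).  Generalises the tree's `IsTilt.map_of_comp` (density factoring through `f`).
§2 **`descendTo F ℰ n K h`** (`n ≤ K`): the `K`-th approximation's fine field averaged `K − n` times and read on the finest lattice
   of the `n`-th approximation (same spacing `L^{-n}`, `T3LevelShift.fieldShift`); **`unitA_descendTo : A_n ∘ D_{n,K} = A_K`**
   ([Balaban1987RG1] (0.11) `Ū^{k} = M^{k}(U)` across the towers: `iter_add` + `iterFrom_fieldShift`); measurability.
§3 **`isTilt_unitA_of_isTilt_descendTo`**: a tilt of radius `r` between `(D_{n,K})_*(Gibbs_K|S₀)` and `(D_{n,K+1})_*(Gibbs_{K+1}|S₁)`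
   gives the route's unit-lattice tilt of radius `r`; **`unitTiltAt_of_descendedTilt`**: with `n = ⌊K/m⌋` and the history events,
   summable radii ⇒ `UnitTiltAt F γ b₀ p₀ m`.
§4 THE SAME IN THE DENSITY CURRENCY at height `K − n`: `heightDensity` = the restricted density `ρ^{S}_{K−n}` of
   `T3RestrictedUnitDensity` read on the `n`-th tower's finest lattice, **`map_descendTo_restrict_eq_withDensity`**
   (`(D_{n,K})_*(Gibbs_K|S) = dU^{(n)}.withDensity (Z_K⁻¹ ρ^{S}_{K−n})`, hypothesis-free at the printed smearing on `SU(2)`),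
   **`isTilt_descendTo_of_sandwich_ae`** and **`unitTiltAt_of_heightSandwich`**: an a.e. two-run sandwich modulo a free constant,
   `e^{−r_K} c_K ρ^{(K),Gd}_{K−n} ≤ ρ^{(K+1),Gd}_{K+1−n} ≤ e^{r_K} c_K ρ^{(K),Gd}_{K−n}` on the `η`-lattice fields with `Σ r_K < ∞`
   ⇒ `UnitTiltAt F γ b₀ p₀ m`.  This is the E3 crux in the exact currency of [Balaban1985UV3] (41): both densities are small-field
   effective densities with ALL their heights constrained.
-/

noncomputable section

open MeasureTheory Filter Topology
open Literature.MathematicalPhysics.QuantumFieldTheory.Balaban1983to89.T3ContinuumYM3Torus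
open Literature.MathematicalPhysics.QuantumFieldTheory.Balaban1983to89.T3LevelShift
open Literature.MathematicalPhysics.QuantumFieldTheory.Balaban1983to89.T3ThresholdRemoval
open Literature.MathematicalPhysics.QuantumFieldTheory.Balaban1983to89.T3NestedUnitLaws
open Literature.MathematicalPhysics.QuantumFieldTheory.Balaban1983to89.T3UnitLawDensityEML
open Literature.MathematicalPhysics.QuantumFieldTheory.Balaban1983to89.T3UnitScaleTilt
open Literature.MathematicalPhysics.QuantumFieldTheory.Balaban1983to89.T3RestrictedUnitDensity
open Literature.MathematicalPhysics.QuantumFieldTheory.Balaban1983to89.Missing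
open Literature.MathematicalPhysics.QuantumFieldTheory.Balaban1983to89.T4Continuum

namespace Literature.MathematicalPhysics.QuantumFieldTheory.Balaban1983to89.T3TiltDescent

/-! ## §1 Tilts push forward under every measurable map -/

section Push

variable {X Y : Type*} [MeasurableSpace X] [MeasurableSpace Y]

/-- Two-sided bounds of a tilt on measurable sets: `Ce^{−r}·μ(s) ≤ ν(s) ≤ Ce^{r}·μ(s)` (local helper). [folklore] -/
private theorem tilt_set_bounds {μ ν : Measure X} {r C : ℝ} {g : X → ℝ} (hg : ∀ x, |g x| ≤ r)
    (hν : ν = μ.withDensity fun x => ENNReal.ofReal (C * Real.exp (g x))) (hC : 0 ≤ C) {s : Set X}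
    (hs : MeasurableSet s) :
    ENNReal.ofReal (C * Real.exp (-r)) * μ s ≤ ν s ∧ ν s ≤ ENNReal.ofReal (C * Real.exp r) * μ s := by
  rw [hν, withDensity_apply _ hs]
  constructor
  · calc ENNReal.ofReal (C * Real.exp (-r)) * μ s
        = ∫⁻ _ in s, ENNReal.ofReal (C * Real.exp (-r)) ∂μ := (setLIntegral_const _ _).symm
      _ ≤ ∫⁻ x in s, ENNReal.ofReal (C * Real.exp (g x)) ∂μ :=
          lintegral_mono fun x => ENNReal.ofReal_le_ofReal
            (mul_le_mul_of_nonneg_left (Real.exp_le_exp.mpr (abs_le.mp (hg x)).1) hC)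
  · calc ∫⁻ x in s, ENNReal.ofReal (C * Real.exp (g x)) ∂μ
        ≤ ∫⁻ _ in s, ENNReal.ofReal (C * Real.exp r) ∂μ :=
          lintegral_mono fun x => ENNReal.ofReal_le_ofReal
            (mul_le_mul_of_nonneg_left (Real.exp_le_exp.mpr (abs_le.mp (hg x)).2) hC)
      _ = ENNReal.ofReal (C * Real.exp r) * μ s := setLIntegral_const _ _

/-- **TILTS PUSH FORWARD UNDER EVERY MEASURABLE MAP, SAME RADIUS** (`μ` finite): if `ν = C·e^{h}·μ` with `sup |h| ≤ r` then
`ν.map f = C·e^{h'}·(μ.map f)` with `h'` measurable, `sup |h'| ≤ r`.  Proof: the push-forwards satisfy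
`Ce^{−r}·(μ.map f) ≤ ν.map f ≤ Ce^{r}·(μ.map f)` setwise, so the Radon–Nikodym derivative lies in `[Ce^{−r}, Ce^{r}]` almost
everywhere; clip it.  This is «the free block averagings cost nothing» of the two-cut-off comparison: [King1986] compares the
densities at the scale `L^kε` ((3.9)) and concludes for every observable of the coarser fields. [cite: King1986, Thm 3.4 (3.9) p.656 and Thm 2.1 p.654] -/
theorem _root_.Literature.MathematicalPhysics.QuantumFieldTheory.Balaban1983to89.T3UnitScaleTilt.IsTilt.map_measure
    {μ ν : Measure X} [IsFiniteMeasure μ] {r : ℝ} (ht : IsTilt μ ν r) {f : X → Y}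
    (hf : Measurable f) : IsTilt (μ.map f) (ν.map f) r := by
  classical
  obtain ⟨hr, g, C, hgm, hC, hg, hν⟩ := ht
  rcases hC.eq_or_lt with hC0 | hCpos
  · -- `C = 0`: `ν = 0`
    have hν0 : ν = 0 := by rw [hν, ← hC0]; simp
    rw [hν0, Measure.map_zero]
    exact IsTilt.zero_right _ hr
  -- the pushed-forward measures and their setwise bounds
  set μ' := μ.map f with hμ'
  set ν' := ν.map f with hν'
  set a : ℝ := C * Real.exp (-r) with ha
  set b : ℝ := C * Real.exp r with hb
  have ha0 : 0 < a := mul_pos hCpos (Real.exp_pos _)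
  have hab : a ≤ b := mul_le_mul_of_nonneg_left (Real.exp_le_exp.mpr (by linarith)) hC
  have hbounds : ∀ t, MeasurableSet t → ENNReal.ofReal a * μ' t ≤ ν' t ∧ ν' t ≤ ENNReal.ofReal b * μ' t := by
    intro t ht
    rw [hμ', hν', Measure.map_apply hf ht, Measure.map_apply hf ht]
    exact tilt_set_bounds hg hν hC (hf ht)
  haveI : IsFiniteMeasure μ' := Measure.isFiniteMeasure_map μ f
  have hle : ν' ≤ ENNReal.ofReal b • μ' := by
    refine Measure.le_iff.mpr fun t ht => ?_
    rw [Measure.smul_apply, smul_eq_mul]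
    exact (hbounds t ht).2
  haveI : IsFiniteMeasure ν' := by
    refine ⟨lt_of_le_of_lt (hle Set.univ) ?_⟩
    rw [Measure.smul_apply, smul_eq_mul]
    exact ENNReal.mul_lt_top ENNReal.ofReal_lt_top (measure_lt_top _ _)
  have hac : ν' ≪ μ' := Measure.absolutelyContinuous_of_le_smul hle
  -- the Radon–Nikodym derivative and its a.e. bounds
  set d := ν'.rnDeriv μ' with hd
  have hdm : Measurable d := Measure.measurable_rnDeriv _ _
  have hνd : ν' = μ'.withDensity d := (Measure.withDensity_rnDeriv_eq _ _ hac).symm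
  have hset : ∀ t, MeasurableSet t → ∫⁻ x in t, d x ∂μ' = ν' t := fun t ht => by
    rw [hνd, withDensity_apply _ ht]
  have hup : d ≤ᵐ[μ'] fun _ => ENNReal.ofReal b := by
    refine ae_le_of_forall_setLIntegral_le_of_sigmaFinite hdm fun t ht _ => ?_
    rw [hset t ht, setLIntegral_const]
    exact (hbounds t ht).2
  have hlo : (fun _ => ENNReal.ofReal a) ≤ᵐ[μ'] d := by
    refine ae_le_of_forall_setLIntegral_le_of_sigmaFinite measurable_const fun t ht _ => ?_
    rw [hset t ht, setLIntegral_const]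
    exact (hbounds t ht).1
  -- the clipped real density and its logarithm
  let ρ : Y → ℝ := fun y => max a (min b (d y).toReal)
  have hρm : Measurable ρ := measurable_const.max (measurable_const.min hdm.ennreal_toReal)
  have hρa : ∀ y, a ≤ ρ y := fun y => le_max_left _ _
  have hρb : ∀ y, ρ y ≤ b := fun y => max_le hab (min_le_left _ _)
  have hρpos : ∀ y, 0 < ρ y := fun y => lt_of_lt_of_le ha0 (hρa y)
  let h' : Y → ℝ := fun y => Real.log (ρ y / C)
  have hh'm : Measurable h' := (hρm.div_const C).log
  have hh' : ∀ y, |h' y| ≤ r := by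
    intro y
    have hq : 0 < ρ y / C := div_pos (hρpos y) hCpos
    have h1 : Real.exp (-r) ≤ ρ y / C := by
      rw [le_div_iff₀ hCpos]; have := hρa y; rw [ha] at this; linarith
    have h2 : ρ y / C ≤ Real.exp r := by
      rw [div_le_iff₀ hCpos]; have := hρb y; rw [hb] at this; linarith
    rw [abs_le]
    constructor
    · have := Real.log_le_log (Real.exp_pos _) h1; rwa [Real.log_exp] at this
    · have := Real.log_le_log hq h2; rwa [Real.log_exp] at this
  have hCexp : ∀ y, C * Real.exp (h' y) = ρ y := fun y => by
    show C * Real.exp (Real.log (ρ y / C)) = ρ y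
    rw [Real.exp_log (div_pos (hρpos y) hCpos)]
    field_simp
  refine ⟨hr, h', C, hh'm, hC, hh', ?_⟩
  rw [hνd]
  refine withDensity_congr_ae ?_
  filter_upwards [hup, hlo] with y hyu hyl
  have htop : d y ≠ ⊤ := ne_top_of_le_ne_top ENNReal.ofReal_ne_top hyu
  have hreal : a ≤ (d y).toReal ∧ (d y).toReal ≤ b := by
    constructor
    · have := ENNReal.toReal_mono htop hyl
      rwa [ENNReal.toReal_ofReal ha0.le] at this
    · have := ENNReal.toReal_mono ENNReal.ofReal_ne_top hyu
      rwa [ENNReal.toReal_ofReal (ha0.le.trans hab)] at this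
  have hρy : ρ y = (d y).toReal := by
    show max a (min b (d y).toReal) = (d y).toReal
    rw [min_eq_right hreal.2, max_eq_right hreal.1]
  rw [hCexp, hρy, ENNReal.ofReal_toReal htop]

end Push

/-! ## §2 Descending the `K`-th approximation to the `n`-th: `A_K = A_n ∘ D_{n,K}` -/

section Descend

variable (F : T3Family) {G : Type*} [GaugeGroup G] (ℰ : LoopAverage G)

/-- **`D_{n,K}`: THE `K`-TH APPROXIMATION'S FIELD DESCENDED TO THE `n`-TH** (`n ≤ K`): average `K − n` times by (0.4) and read the
height-`(K−n)` field of the `K`-th tower (spacing `L^{K−n}ε_K = L^{-n}`) as the finest field of the `n`-th tower (same spacing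
`ε_n = L^{-n}`, `T3LevelShift.fieldShift`).  [Balaban1987RG1] (0.11): `Ū^{k} = M^{k}(U)` is one formula at every level. [cite: Balaban1987RG1, (0.11) p.253] -/
def descendTo (n K : ℕ) (h : n ≤ K) (U : GaugeField (F.P K) 0 G) : GaugeField (F.P n) 0 G :=
  fieldShift (F.sitesPerDir_eq (m := F.m) (K := n) (j := 0) (m' := F.m) (K' := K) (j' := K - n) (by omega))
    (Averaging.iter (fun i => BlockAveraging.blockAvg (P := F.P K) (j := i) ℰ) (K - n) U)

/-- Reindexing an iterated averaging along a propositional equality of the number of steps (local helper). [folklore] -/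
private theorem fieldShift_iter_of_eq {K a b : ℕ} (hab : a = b) (U : GaugeField (F.PP F.m K) 0 G) :
    fieldShift (F.sitesPerDir_eq (m := F.m) (K := K) (j := a) (m' := F.m) (K' := K) (j' := b) (by omega))
        (Averaging.iter (fun i => BlockAveraging.blockAvg (P := F.PP F.m K) (j := i) ℰ) b U) =
      Averaging.iter (fun i => BlockAveraging.blockAvg (P := F.PP F.m K) (j := i) ℰ) a U := by
  subst hab
  exact fieldShift_refl _ _

/-- **`A_K = A_n ∘ D_{n,K}`**: the unit transport of the `K`-th approximation IS the unit transport of the `n`-th applied to the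
descended field (`avg^{K} = avg^{n} ∘ avg^{K−n}` across the two towers: `iter_add`, `iterFrom_fieldShift`). [cite: Balaban1987RG1, (0.11) p.253] -/
theorem unitA_descendTo {n K : ℕ} (h : n ≤ K) (U : GaugeField (F.P K) 0 G) :
    unitA F ℰ n (descendTo F ℰ n K h U) = unitA F ℰ K U := by
  show fieldShift (F.sitesPerDir_unit n)
      (Averaging.iter (fun i => BlockAveraging.blockAvg (P := F.PP F.m n) (j := i) ℰ) n
        (fieldShift _ (Averaging.iter (fun i => BlockAveraging.blockAvg (P := F.PP F.m K) (j := i) ℰ) (K - n) U))) =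
    fieldShift (F.sitesPerDir_unit K) (Averaging.iter (fun i => BlockAveraging.blockAvg (P := F.PP F.m K) (j := i) ℰ) K U)
  rw [← iterFrom_fieldShift ℰ (show F.m + K = F.m + n + (K - n) by omega) n, fieldShift_fieldShift,
    ← T4AvgSensitivity.iter_add, ← fieldShift_iter_of_eq F ℰ (show K = K - n + n by omega) U, fieldShift_fieldShift]

/-- In function form: `unitA n ∘ descendTo n K = unitA K`. [cite: Balaban1987RG1, (0.11) p.253] -/
theorem unitA_comp_descendTo {n K : ℕ} (h : n ≤ K) :
    unitA F ℰ n ∘ descendTo F ℰ n K h = (unitA F ℰ K : GaugeField (F.P K) 0 G → GaugeField (F.P 0) 0 G) :=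
  funext fun U => unitA_descendTo F ℰ h U

variable [MeasurableSpace G] [RegularGaugeGroup G]

/-- `D_{n,K}` is measurable for a measurable small-loop average. [cite: Balaban1985Averaging, (10) p.19] -/
theorem measurable_descendTo (hE : ℰ.MeasurableE) {n K : ℕ} (h : n ≤ K) :
    Measurable (descendTo F ℰ n K h : GaugeField (F.P K) 0 G → GaugeField (F.P n) 0 G) :=
  (measurable_fieldShift _).comp (measurable_iter _ (F.avgMeasurable_of_measurableE ℰ hE K) (K - n))

end Descend

/-! ## §3 K1 at the unit lattice from a tilt at the comparison scale -/

section UnitFromHeight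

variable (F : T3Family) {G : Type*} [GaugeGroup G] [MeasurableSpace G] [HaarData G] [RegularGaugeGroup G]
  (ℰ : LoopAverage G) (hE : ℰ.MeasurableE) {γ : ℝ} (hγ : 0 ≤ γ)

include hE hγ in
/-- **K1 AT THE UNIT LATTICE ⇐ A TILT AT THE COMPARISON SCALE**: if the restricted Gibbs measures of run `K` (event `S₀`) and run
`K+1` (event `S₁`), both DESCENDED to the finest lattice of the `n`-th approximation (`n ≤ K`; spacing `η = L^{-n}`), are tilts of
each other with radius `r`, then so are their unit-lattice push-forwards — the `n` free averagings cost nothing (§1 + §2).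
[cite: King1986, Thm 3.4 (3.9) p.656 and Thm 2.1 p.654] -/
theorem isTilt_unitA_of_isTilt_descendTo {n K : ℕ} (hK : n ≤ K) (S₀ : Set (GaugeField (F.P K) 0 G))
    (S₁ : Set (GaugeField (F.P (K + 1)) 0 G)) {r : ℝ}
    (h : IsTilt (Measure.map (descendTo F ℰ n K hK) ((gibbsK F ℰ γ K).restrict S₀))
      (Measure.map (descendTo F ℰ n (K + 1) (hK.trans (Nat.le_succ K))) ((gibbsK F ℰ γ (K + 1)).restrict S₁)) r) :
    IsTilt (Measure.map (unitA F ℰ K) ((gibbsK F ℰ γ K).restrict S₀))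
      (Measure.map (unitA F ℰ (K + 1)) ((gibbsK F ℰ γ (K + 1)).restrict S₁)) r := by
  haveI := isProbabilityMeasure_gibbsK F ℰ hγ K
  haveI : IsFiniteMeasure (Measure.map (descendTo F ℰ n K hK) ((gibbsK F ℰ γ K).restrict S₀)) :=
    Measure.isFiniteMeasure_map _ _
  rw [← unitA_comp_descendTo F ℰ hK, ← unitA_comp_descendTo F ℰ (hK.trans (Nat.le_succ K)),
    ← Measure.map_map (measurable_unitA F ℰ hE n) (measurable_descendTo F ℰ hE hK),
    ← Measure.map_map (measurable_unitA F ℰ hE n) (measurable_descendTo F ℰ hE (hK.trans (Nat.le_succ K)))]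
  exact h.map_measure (measurable_unitA F ℰ hE n)

end UnitFromHeight

section RouteHeight

/-- **THE ROUTE'S K1 BODY ⇐ DESCENDED TILTS AT `η = L^{-⌊K/m⌋}`**: if for every `K` the two consecutive approximations' Gibbs
measures restricted to Bałaban's UV-small-history events (with `⌊K/m⌋` free top steps), both descended to the finest lattice of the
`⌊K/m⌋`-th approximation, are tilts of each other with radii `r_K`, `Σ r_K < ∞`, then `UnitTiltAt F γ b₀ p₀ m` (`γ ≥ 0`; printed
smearing on `SU(2)`).  ON THE DESCENDED LATTICE EVERY HEIGHT IS CONSTRAINED: the events bound all the plaquette variables of all the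
averaged fields that the descended field still remembers. [cite: King1986, Thm 3.4 (3.9)-(3.13) p.656] -/
theorem unitTiltAt_of_descendedTilt (F : T3Family) {γ : ℝ} (hγ : 0 ≤ γ) (b₀ p₀ : ℝ) (m : ℕ) {r : ℕ → ℝ}
    (hr : Summable r)
    (h : ∀ K, IsTilt
      (Measure.map (descendTo F ℰp (K / m) K (Nat.div_le_self K m))
        ((gibbsK F ℰp γ K).restrict (histGood F ℰp (θBal F.L γ b₀ p₀) K (K / m))))
      (Measure.map (descendTo F ℰp (K / m) (K + 1) ((Nat.div_le_self K m).trans (Nat.le_succ K)))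
        ((gibbsK F ℰp γ (K + 1)).restrict (histGood F ℰp (θBal F.L γ b₀ p₀) (K + 1) (K / m))))
      (r K)) :
    UnitTiltAt F γ b₀ p₀ m :=
  ⟨r, hr, fun K => isTilt_unitA_of_isTilt_descendTo F ℰp measurableE_ℰp hγ (Nat.div_le_self K m) _ _ (h K)⟩

end RouteHeight

/-! ## §4 The same in the density currency at the last constrained height -/

section HeightDensity

variable (F : T3Family) (γ : ℝ) {n K : ℕ} (hK : n ≤ K) (S : Set (GaugeField (F.P K) 0 (Matrix.specialUnitaryGroup (Fin 2) ℂ)))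

/-- **THE RESTRICTED DENSITY AT HEIGHT `K − n`, READ ON THE `n`-TH TOWER'S FINEST LATTICE**: `ρ^{S}_{K−n}(fieldShift V)` — Bałaban's
`T_{K−n−1}⋯T_0(1_S e^{−β_K A})` at the comparison scale `η = L^{-n}` (unnormalised). [cite: Balaban1985UV3, (2) p.256 and (41) p.266] -/
def heightDensity (V : GaugeField (F.P n) 0 (Matrix.specialUnitaryGroup (Fin 2) ℂ)) : ℝ :=
  resDensity F γ K S (K - n)
    (fieldShift (F.sitesPerDir_eq (m := F.m) (K := K) (j := K - n) (m' := F.m) (K' := n) (j' := 0) (by omega)) V)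

/-- `heightDensity (descendTo-reading of W) = ρ^S_{K−n}(W)`. [cite: Balaban1985UV3, (2) p.256] -/
theorem heightDensity_fieldShift (W : GaugeField (F.P K) (K - n) (Matrix.specialUnitaryGroup (Fin 2) ℂ)) :
    heightDensity F γ hK S
        (fieldShift (F.sitesPerDir_eq (m := F.m) (K := n) (j := 0) (m' := F.m) (K' := K) (j' := K - n) (by omega)) W) =
      resDensity F γ K S (K - n) W := by
  unfold heightDensity
  rw [fieldShift_fieldShift, fieldShift_refl]

/-- `heightDensity ≥ 0`. [cite: Balaban1985UV3, (2) p.256] -/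
theorem heightDensity_nonneg (V : GaugeField (F.P n) 0 (Matrix.specialUnitaryGroup (Fin 2) ℂ)) :
    0 ≤ heightDensity F γ hK S V :=
  resDensity_nonneg F γ K S _ _

variable {γ S}

/-- `heightDensity` is measurable and integrable (`γ ≥ 0`, `S` measurable). [cite: Balaban1985UV3, (6) p.257] -/
theorem heightDensity_props (hS : MeasurableSet S) (hγ : 0 ≤ γ) :
    Measurable (heightDensity F γ hK S) ∧
      Integrable (heightDensity F γ hK S) (fieldMeasure (F.P n) 0 (Matrix.specialUnitaryGroup (Fin 2) ℂ)) :=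
  ⟨(measurable_resDensity F γ K hS (K - n)).comp (measurable_fieldShift _),
    (measurePreserving_fieldShift _).integrable_comp_of_integrable
      (integrable_resDensity F K hS hγ (by omega))⟩

/-- **INTEGRATION AGAINST THE DESCENDED RESTRICTED GIBBS MEASURE**: for bounded measurable `f` on the `n`-th tower's finest fields,
`∫ f d((D_{n,K})_*(Gibbs_K|S)) = (∫ ρ^S_{K−n}(W)·f(fieldShift W) dV_{K−n})/Z_K`. [cite: Balaban1985UV3, (2) p.256 + (6) p.257] -/
theorem integral_map_descendTo_restrict (hS : MeasurableSet S) (hγ : 0 ≤ γ)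
    (f : GaugeField (F.P n) 0 (Matrix.specialUnitaryGroup (Fin 2) ℂ) → ℝ) (hf : Measurable f) (hC : ∃ C : ℝ, ∀ u, |f u| ≤ C) :
    ∫ V, f V ∂Measure.map (descendTo F ℰp n K hK) ((gibbsK F ℰp γ K).restrict S) =
      (∫ W, resDensity F γ K S (K - n) W *
          f (fieldShift (F.sitesPerDir_eq (m := F.m) (K := n) (j := 0) (m' := F.m) (K' := K) (j' := K - n) (by omega)) W)
          ∂fieldMeasure (F.P K) (K - n) (Matrix.specialUnitaryGroup (Fin 2) ℂ)) /
        partitionFn (G := Matrix.specialUnitaryGroup (Fin 2) ℂ) (F.P K) ((F.scheme ℰp γ).β K) := by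
  obtain ⟨C, hC⟩ := hC
  rw [integral_map (measurable_descendTo F ℰp measurableE_ℰp hK).aemeasurable hf.aestronglyMeasurable,
    ← integral_indicator hS, gibbsK_eq, T4GenFunBounds.integral_gibbsMeasure _ (F.scheme_β_nonneg ℰp hγ K),
    integral_resDensity_mul F K hS hγ (k := K - n) (by omega) (fun W => f (fieldShift _ W))
      (hf.comp (measurable_fieldShift _)) ⟨C, fun W => hC _⟩]
  congr 1
  refine integral_congr_ae (Eventually.of_forall fun U => ?_)
  show S.indicator (fun U => f (descendTo F ℰp n K hK U)) U * boltzmann (F.P K) ((F.scheme ℰp γ).β K) U =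
    S.indicator (boltzmann (F.P K) ((F.scheme ℰp γ).β K)) U * f (descendTo F ℰp n K hK U)
  by_cases hU : U ∈ S
  · rw [Set.indicator_of_mem hU, Set.indicator_of_mem hU, mul_comm]
  · rw [Set.indicator_of_notMem hU, Set.indicator_of_notMem hU, zero_mul, zero_mul]

/-- Two finite measures with equal integrals of all measurable `f`, `|f| ≤ 1`, are equal (local helper). [folklore] -/
private theorem ext_of_forall_integral_eq {X : Type*} [MeasurableSpace X] {μ ν : Measure X} [IsFiniteMeasure μ]
    [IsFiniteMeasure ν] (h : ∀ f : X → ℝ, Measurable f → (∀ x, |f x| ≤ 1) → ∫ x, f x ∂μ = ∫ x, f x ∂ν) : μ = ν := by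
  refine Measure.ext fun s hs => ?_
  have hb : ∀ y, |s.indicator (1 : X → ℝ) y| ≤ 1 := fun y => by
    by_cases hy : y ∈ s
    · simp [hy]
    · simp [hy]
  have h1 := h _ (measurable_one.indicator hs) hb
  rw [integral_indicator_one hs, integral_indicator_one hs] at h1
  exact (ENNReal.toReal_eq_toReal_iff' (measure_ne_top _ _) (measure_ne_top _ _)).mp h1

/-- **THE DESCENDED RESTRICTED GIBBS MEASURE HAS THE DENSITY `Z_K⁻¹ρ^S_{K−n}` WITH RESPECT TO PRODUCT HAAR ON THE `η`-LATTICE** —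
hypothesis-free at the printed smearing on `SU(2)` (`γ ≥ 0`, `S` measurable, `n ≤ K`):
`(D_{n,K})_*(Gibbs_K|S) = dU^{(n)}.withDensity (Z_K⁻¹ · heightDensity)`. [cite: Balaban1985UV3, (2) p.256 + (6) p.257] -/
theorem map_descendTo_restrict_eq_withDensity (hS : MeasurableSet S) (hγ : 0 ≤ γ) :
    Measure.map (descendTo F ℰp n K hK) ((gibbsK F ℰp γ K).restrict S) =
      (fieldMeasure (F.P n) 0 (Matrix.specialUnitaryGroup (Fin 2) ℂ)).withDensity (fun V => ENNReal.ofReal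
        ((partitionFn (G := Matrix.specialUnitaryGroup (Fin 2) ℂ) (F.P K) ((F.scheme ℰp γ).β K))⁻¹ *
          heightDensity F γ hK S V)) := by
  obtain ⟨hdm, hdi⟩ := heightDensity_props F hK hS hγ
  have hd0 := heightDensity_nonneg F γ hK S
  have hZ : 0 < partitionFn (G := Matrix.specialUnitaryGroup (Fin 2) ℂ) (F.P K) ((F.scheme ℰp γ).β K) :=
    partitionFn_pos' _ (F.scheme_β_nonneg ℰp hγ K)
  set Z := partitionFn (G := Matrix.specialUnitaryGroup (Fin 2) ℂ) (F.P K) ((F.scheme ℰp γ).β K) with hZdef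
  have hm : Measurable fun V => Z⁻¹ * heightDensity F γ hK S V := hdm.const_mul _
  have h0 : ∀ V, 0 ≤ Z⁻¹ * heightDensity F γ hK S V := fun V => mul_nonneg (inv_nonneg.mpr hZ.le) (hd0 V)
  haveI := isProbabilityMeasure_gibbsK F ℰp hγ K
  haveI : IsFiniteMeasure ((fieldMeasure (F.P n) 0 (Matrix.specialUnitaryGroup (Fin 2) ℂ)).withDensity
      fun V => ENNReal.ofReal (Z⁻¹ * heightDensity F γ hK S V)) :=
    isFiniteMeasure_withDensity_ofReal (hdi.const_mul _).2
  refine ext_of_forall_integral_eq fun f hf hb => ?_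
  rw [integral_map_descendTo_restrict F hK hS hγ f hf ⟨1, hb⟩, T4VarianceMatching.integral_withDensity_ofReal_mul hm h0 f]
  have hcv : ∫ V, Z⁻¹ * heightDensity F γ hK S V * f V ∂fieldMeasure (F.P n) 0 (Matrix.specialUnitaryGroup (Fin 2) ℂ) =
      ∫ W, Z⁻¹ * heightDensity F γ hK S
          (fieldShift (F.sitesPerDir_eq (m := F.m) (K := n) (j := 0) (m' := F.m) (K' := K) (j' := K - n) (by omega)) W) *
        f (fieldShift (F.sitesPerDir_eq (m := F.m) (K := n) (j := 0) (m' := F.m) (K' := K) (j' := K - n) (by omega)) W)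
        ∂fieldMeasure (F.P K) (K - n) (Matrix.specialUnitaryGroup (Fin 2) ℂ) :=
    (integral_comp_fieldShift _ (fun V => Z⁻¹ * heightDensity F γ hK S V * f V)).symm
  rw [hcv]
  simp_rw [heightDensity_fieldShift]
  rw [← integral_div]
  refine integral_congr_ae (Eventually.of_forall fun W => ?_)
  ring

end HeightDensity

section HeightSandwich

variable (F : T3Family) {γ : ℝ} (hγ : 0 ≤ γ) {n K : ℕ} (hK : n ≤ K)
  {S₀ : Set (GaugeField (F.P K) 0 (Matrix.specialUnitaryGroup (Fin 2) ℂ))}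
  {S₁ : Set (GaugeField (F.P (K + 1)) 0 (Matrix.specialUnitaryGroup (Fin 2) ℂ))}

include hγ

/-- **THE DESCENDED TILT ⇐ A TWO-RUN SANDWICH OF THE RESTRICTED DENSITIES AT THE COMPARISON SCALE, MODULO A CONSTANT**: an a.e.
sandwich `e^{−r}·c·ρ^{(K),S₀}_{K−n} ≤ ρ^{(K+1),S₁}_{K+1−n} ≤ e^{r}·c·ρ^{(K),S₀}_{K−n}` on the `η`-lattice fields (both read on the
`n`-th tower, `c > 0` free: no matching of `Z_K`, `Z_{K+1}` or vacuum energies) gives the tilt of radius `r` between the two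
descended restricted Gibbs measures. [cite: King1986, Thm 3.4 (3.9) p.656] -/
theorem isTilt_descendTo_of_sandwich_ae (hS₀ : MeasurableSet S₀) (hS₁ : MeasurableSet S₁) {r c : ℝ} (hr : 0 ≤ r)
    (hc : 0 < c)
    (hsand : ∀ᵐ V ∂fieldMeasure (F.P n) 0 (Matrix.specialUnitaryGroup (Fin 2) ℂ),
      Real.exp (-r) * c * heightDensity F γ hK S₀ V ≤ heightDensity F γ (hK.trans (Nat.le_succ K)) S₁ V ∧
      heightDensity F γ (hK.trans (Nat.le_succ K)) S₁ V ≤ Real.exp r * c * heightDensity F γ hK S₀ V) :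
    IsTilt (Measure.map (descendTo F ℰp n K hK) ((gibbsK F ℰp γ K).restrict S₀))
      (Measure.map (descendTo F ℰp n (K + 1) (hK.trans (Nat.le_succ K))) ((gibbsK F ℰp γ (K + 1)).restrict S₁)) r := by
  let Z : ℕ → ℝ := fun K =>
    partitionFn (G := Matrix.specialUnitaryGroup (Fin 2) ℂ) (F.P K) ((F.scheme ℰp γ).β K)
  have hZ : ∀ K, 0 < Z K := fun K => partitionFn_pos' _ (F.scheme_β_nonneg ℰp hγ K)
  rw [map_descendTo_restrict_eq_withDensity F hK hS₀ hγ,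
    map_descendTo_restrict_eq_withDensity F (hK.trans (Nat.le_succ K)) hS₁ hγ]
  refine isTilt_withDensity_of_sandwich_ae _ ((heightDensity_props F hK hS₀ hγ).1.const_mul _)
    ((heightDensity_props F (hK.trans (Nat.le_succ K)) hS₁ hγ).1.const_mul _)
    (fun V => mul_nonneg (inv_nonneg.mpr (hZ K).le) (heightDensity_nonneg F γ hK S₀ V))
    (fun V => mul_nonneg (inv_nonneg.mpr (hZ (K + 1)).le) (heightDensity_nonneg F γ _ S₁ V)) hr
    (c := c * Z K / Z (K + 1)) (div_pos (mul_pos hc (hZ K)) (hZ (K + 1))) (hsand.mono fun V hV => ?_)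
  obtain ⟨h1, h2⟩ := hV
  have hZK : Z K ≠ 0 := (hZ K).ne'
  have hZK1 : 0 < Z (K + 1) := hZ (K + 1)
  constructor
  · show Real.exp (-r) * (c * Z K / Z (K + 1)) * ((Z K)⁻¹ * heightDensity F γ hK S₀ V) ≤
      (Z (K + 1))⁻¹ * heightDensity F γ _ S₁ V
    have e : Real.exp (-r) * (c * Z K / Z (K + 1)) * ((Z K)⁻¹ * heightDensity F γ hK S₀ V) =
        (Z (K + 1))⁻¹ * (Real.exp (-r) * c * heightDensity F γ hK S₀ V) := by
      field_simp
    rw [e]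
    exact mul_le_mul_of_nonneg_left h1 (inv_nonneg.mpr hZK1.le)
  · show (Z (K + 1))⁻¹ * heightDensity F γ _ S₁ V ≤
      Real.exp r * (c * Z K / Z (K + 1)) * ((Z K)⁻¹ * heightDensity F γ hK S₀ V)
    have e : Real.exp r * (c * Z K / Z (K + 1)) * ((Z K)⁻¹ * heightDensity F γ hK S₀ V) =
        (Z (K + 1))⁻¹ * (Real.exp r * c * heightDensity F γ hK S₀ V) := by
      field_simp
    rw [e]
    exact mul_le_mul_of_nonneg_left h2 (inv_nonneg.mpr hZK1.le)

end HeightSandwich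

section RouteDensity

/-- **THE ROUTE'S K1 BODY ⇐ TWO-RUN SANDWICHES OF BAŁABAN'S FULLY-CONSTRAINED RESTRICTED DENSITIES AT `η = L^{-⌊K/m⌋}`**: if for
every `K` the restricted densities `ρ^{(K),Gd_K}_{K−n}` and `ρ^{(K+1),Gd'_K}_{K+1−n}` (`n = ⌊K/m⌋`; both runs read on the `n`-th
tower's finest lattice; `Gd` = the UV-small-history events, which constrain EVERY height these densities have integrated out)
satisfy an a.e. two-run sandwich modulo a free constant `c_K > 0` with radii `r_K ≥ 0`, `Σ r_K < ∞`, then `UnitTiltAt F γ b₀ p₀ m`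
(`γ ≥ 0`).  THIS is the d = 3 expectations step in [Balaban1985UV3]'s own currency: (41) there is the ONE-run lower envelope of
exactly `ρ^{(K),Gd}_{K−n}`; the crux is the comparison of two consecutive runs. [cite: Balaban1985UV3, (41) p.266 and (47) p.267] -/
theorem unitTiltAt_of_heightSandwich (F : T3Family) {γ : ℝ} (hγ : 0 ≤ γ) (b₀ p₀ : ℝ) (m : ℕ) {r : ℕ → ℝ} (hr : Summable r)
    (hr0 : ∀ K, 0 ≤ r K) (c : ℕ → ℝ) (hc : ∀ K, 0 < c K)
    (hsand : ∀ K, ∀ᵐ V ∂fieldMeasure (F.P (K / m)) 0 (Matrix.specialUnitaryGroup (Fin 2) ℂ),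
      Real.exp (-r K) * c K *
            heightDensity F γ (Nat.div_le_self K m) (histGood F ℰp (θBal F.L γ b₀ p₀) K (K / m)) V ≤
          heightDensity F γ ((Nat.div_le_self K m).trans (Nat.le_succ K))
            (histGood F ℰp (θBal F.L γ b₀ p₀) (K + 1) (K / m)) V ∧
        heightDensity F γ ((Nat.div_le_self K m).trans (Nat.le_succ K))
            (histGood F ℰp (θBal F.L γ b₀ p₀) (K + 1) (K / m)) V ≤
          Real.exp (r K) * c K *
            heightDensity F γ (Nat.div_le_self K m) (histGood F ℰp (θBal F.L γ b₀ p₀) K (K / m)) V) :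
    UnitTiltAt F γ b₀ p₀ m :=
  unitTiltAt_of_descendedTilt F hγ b₀ p₀ m hr fun K =>
    isTilt_descendTo_of_sandwich_ae F hγ (Nat.div_le_self K m)
      (measurableSet_histGood F ℰp measurableE_ℰp _ K _) (measurableSet_histGood F ℰp measurableE_ℰp _ (K + 1) _)
      (hr0 K) (hc K) (hsand K)

end RouteDensity

end Literature.MathematicalPhysics.QuantumFieldTheory.Balaban1983to89.T3TiltDescent

end
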